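import Literature.Computability.QuantumComplexity.HidingParameters
import HarnessLib

/-!
# The proof of AA13 Thm. 1.3: the pseudo-Gaussian sampler at the machine's parameters

Family `quantum-advantage`, sequel of `HidingParameters.lean`. At the machine's parameters
`P = ⟨b = 16(N+1)², r₀, k, J⟩` (`sP N`) the estimates of `PseudoGaussianSamplerEstimates.lean`
become NUMBERS — the inputs of the real-side domination (`sum_real_roundEvent_le`) and of the
ideal-side moments of the discharge of Aaronson–Arkhipov's Thm. 1.3:

* the small quantities `h = 2^{-b}`, `q = 2^{-k}`, `e^{-R}`, `p₀^J` against `1/(32N²)`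
  (`sP_hR_le`, `sP_qR_sq_le`, `sP_q_le`, `sP_h_le`, `exp_neg_R_le`, `sP_pNone_pow_le`);
* the second moment: `1/400 ≤ v` and **`2v ≤ 1 + 1/n`** (`sP_two_v_le`), hence
  `(2v)ⁿ ≤ 3` (`pow_two_v_le_three`) and `s = 2·4ᵇ·v > 0`, `4ᵇ/200 ≤ s`;
* **the domination factor** `F = e^{hR + 2qR² + q}(1+h)/(1 - p₀^J)`: `gaussBox_le_domF_mul_law`
  and `domF_pow_le_two` (`F^{2n²} ≤ 2`).

All proved, no new named facts.

## References

* S. Aaronson, A. Arkhipov, *The computational complexity of linear optics*, Theory of Computing 9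
  (2013) 143–252, proof of Thm. 1.3, §5.2 (p. 192: "generated by Gram–Schmidt on Gaussians").
-/

noncomputable section

namespace Literature.Computability.QuantumComplexity

open Real Polynomial Literature.Computability.Complexity Literature.Probability.Distributions

/-- The sampler's parameters of the machine at `N`: mesh `2^{-16(N+1)²}`. [folklore] -/
abbrev sP (N : ℕ) : PGParams := hidH.pg (precP.eval N) N

variable {N n : ℕ}

/-! ### The exponents -/

/-- `b = 16(N+1)²`, `r = r₀ N`, `k = k(N)`, `J = J(N)`. [folklore] -/
theorem sP_b (N : ℕ) : (sP N).b = 16 * (N + 1) ^ 2 := precP_eval N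

/-- `1 ≤ b`. [folklore] -/
theorem sP_one_le_b (N : ℕ) : 1 ≤ (sP N).b := by
  rw [sP_b]
  have : 1 ≤ (N + 1) ^ 2 := Nat.one_le_pow _ _ (Nat.succ_pos _)
  omega

/-- `1 ≤ r`. [folklore] -/
theorem sP_one_le_r (N : ℕ) : 1 ≤ (sP N).r := by
  show 1 ≤ HPolys.r₀ N
  have := (two_pow_r₀_bounds N).2.2; omega

/-- `1 ≤ k` for `N ≥ 1`. [folklore] -/
theorem sP_one_le_k (hN : 1 ≤ N) : 1 ≤ (sP N).k := (two_pow_k_bounds N).2.2 hN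

/-- **`R ≤ 16(N+1)`** (reals). [folklore] -/
theorem sP_R_le (N : ℕ) : (sP N).R ≤ 16 * ((N : ℝ) + 1) := by
  have h := (two_pow_r₀_bounds N).2.1
  have hs : Nat.size N ≤ N := Nat.size_le.2 Nat.lt_two_pow_self
  have : (2 : ℝ) ^ HPolys.r₀ N ≤ 16 * ((N : ℝ) + 1) := by
    have h' : ((2 ^ HPolys.r₀ N : ℕ) : ℝ) ≤ ((16 * (Nat.size N + 1) : ℕ) : ℝ) := by exact_mod_cast h
    push_cast at h'
    have : ((Nat.size N : ℕ) : ℝ) ≤ N := by exact_mod_cast hs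
    linarith
  exact this

/-- `16 < R` for `N ≥ 1` (`size N ≥ 1`). [folklore] -/
theorem sP_R_gt (hN : 1 ≤ N) : 16 < (sP N).R := by
  have h := (two_pow_r₀_bounds N).1
  have hs : 1 ≤ Nat.size N := Nat.size_pos.2 hN
  have h' : ((8 * (Nat.size N + 1) : ℕ) : ℝ) < ((2 ^ HPolys.r₀ N : ℕ) : ℝ) := by exact_mod_cast h
  push_cast at h'
  have : (1 : ℝ) ≤ Nat.size N := by exact_mod_cast hs
  show 16 < (2 : ℝ) ^ HPolys.r₀ N
  linarith

/-- `1 ≤ R`. [folklore] -/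
theorem sP_one_le_R (N : ℕ) : 1 ≤ (sP N).R := one_le_pow₀ (by norm_num)

/-! ### The small quantities against `1/(32 N²)` -/

/-- `2ᵇ ≥ 512N²(N+1)` as reals. [folklore] -/
theorem sP_two_pow_b_ge (N : ℕ) : 512 * (N : ℝ) ^ 2 * (N + 1) ≤ (2 : ℝ) ^ (sP N).b := by
  have h := two_pow_precP_ge N
  have h' : ((512 * N ^ 2 * (N + 1) : ℕ) : ℝ) ≤ ((2 ^ precP.eval N : ℕ) : ℝ) := by exact_mod_cast h
  push_cast at h'
  exact h'

/-- **`hR ≤ 1/(32N²)`** (`N ≥ 1`). [folklore] -/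
theorem sP_hR_le (hN : 1 ≤ N) : (sP N).h * (sP N).R ≤ 1 / (32 * (N : ℝ) ^ 2) := by
  have hN' : (1 : ℝ) ≤ N := by exact_mod_cast hN
  have hb := sP_two_pow_b_ge N
  have hR := sP_R_le N
  have hRpos : 0 < (sP N).R := by unfold PGParams.R; positivity
  have h2 : (0 : ℝ) < 2 ^ (sP N).b := by positivity
  unfold PGParams.h
  rw [inv_mul_eq_div, div_le_div_iff₀ h2 (by positivity), one_mul]
  calc (sP N).R * (32 * (N : ℝ) ^ 2) ≤ 16 * ((N : ℝ) + 1) * (32 * (N : ℝ) ^ 2) :=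
        mul_le_mul_of_nonneg_right hR (by positivity)
    _ = 512 * (N : ℝ) ^ 2 * (N + 1) := by ring
    _ ≤ 2 ^ (sP N).b := hb

/-- `h ≤ 1/(32N²)` (`N ≥ 1`). [folklore] -/
theorem sP_h_le (hN : 1 ≤ N) : (sP N).h ≤ 1 / (32 * (N : ℝ) ^ 2) := by
  have h1 := sP_hR_le hN
  have hR : 1 ≤ (sP N).R := sP_one_le_R N
  have hh : 0 < (sP N).h := (sP N).h_pos
  calc (sP N).h = (sP N).h * 1 := (mul_one _).symm
    _ ≤ (sP N).h * (sP N).R := mul_le_mul_of_nonneg_left hR hh.le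
    _ ≤ _ := h1

/-- **`q < 1/kP(N)`**: `2^k > 16384 N²(N+1)²`. [folklore] -/
theorem sP_q_mul_kP_lt (N : ℕ) : (sP N).q * (16384 * (N : ℝ) ^ 2 * (N + 1) ^ 2) < 1 := by
  have h := (two_pow_k_bounds N).1
  have h' : ((16384 * N ^ 2 * (N + 1) ^ 2 : ℕ) : ℝ) < ((2 ^ hidH.k N : ℕ) : ℝ) := by exact_mod_cast h
  push_cast at h'
  unfold PGParams.q
  have h2 : (0 : ℝ) < 2 ^ (sP N).k := by positivity
  calc ((2 : ℝ) ^ (sP N).k)⁻¹ * (16384 * (N : ℝ) ^ 2 * (N + 1) ^ 2) < ((2 : ℝ) ^ (sP N).k)⁻¹ * 2 ^ (sP N).k :=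
        mul_lt_mul_of_pos_left h' (inv_pos.2 h2)
    _ = 1 := inv_mul_cancel₀ h2.ne'

/-- **`qR² ≤ 1/(64N²)`** (`N ≥ 1`). [folklore] -/
theorem sP_qR_sq_le (hN : 1 ≤ N) : (sP N).q * (sP N).R ^ 2 ≤ 1 / (64 * (N : ℝ) ^ 2) := by
  have hN' : (1 : ℝ) ≤ N := by exact_mod_cast hN
  have hq := sP_q_mul_kP_lt N
  have hR := sP_R_le N
  have hq0 : 0 < (sP N).q := (sP N).q_pos
  have hR0 : 0 ≤ (sP N).R := by unfold PGParams.R; positivity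
  rw [le_div_iff₀ (by positivity)]
  have hR2 : (sP N).R ^ 2 ≤ 256 * ((N : ℝ) + 1) ^ 2 := by nlinarith
  calc (sP N).q * (sP N).R ^ 2 * (64 * (N : ℝ) ^ 2) ≤ (sP N).q * (256 * ((N : ℝ) + 1) ^ 2) * (64 * (N : ℝ) ^ 2) := by
        gcongr
    _ = (sP N).q * (16384 * (N : ℝ) ^ 2 * (N + 1) ^ 2) := by ring
    _ ≤ 1 := hq.le

/-- `q ≤ 1/(64N²)` (`N ≥ 1`). [folklore] -/
theorem sP_q_le (hN : 1 ≤ N) : (sP N).q ≤ 1 / (64 * (N : ℝ) ^ 2) := by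
  have h1 := sP_qR_sq_le hN
  have hR : 1 ≤ (sP N).R ^ 2 := one_le_pow₀ (sP_one_le_R N)
  have hq : 0 < (sP N).q := (sP N).q_pos
  calc (sP N).q = (sP N).q * 1 := (mul_one _).symm
    _ ≤ (sP N).q * (sP N).R ^ 2 := mul_le_mul_of_nonneg_left hR hq.le
    _ ≤ _ := h1

/-- `q ≤ 1`. [folklore] -/
theorem sP_q_le_one (N : ℕ) : (sP N).q ≤ 1 := by
  unfold PGParams.q
  exact inv_le_one_of_one_le₀ (one_le_pow₀ (by norm_num))

/-! ### Exponentials of the range -/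

/-- `2ᵐ ≤ eᵐ` for natural `m`. [folklore] -/
theorem two_pow_le_exp_nat (m : ℕ) : (2 : ℝ) ^ m ≤ exp m := by
  rw [← Real.exp_one_pow]
  exact pow_le_pow_left₀ (by norm_num) (by have := Real.exp_one_gt_d9; linarith) m

/-- **`e^{-R} ≤ 1/(256 N⁸)`** and hence `≤ 1/(256N)` (`R ≥ 8 size N + 8`, `2^{size N} > N`). [folklore] -/
theorem exp_neg_R_le (N : ℕ) : exp (-(sP N).R) ≤ 1 / (256 * ((N : ℝ) ^ 8 + 1)) := by
  -- `exp R ≥ 2^R ≥ 2^{8(size N + 1)} = 256 · (2^{size N})⁸ ≥ 256 (N⁸ + 1)`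
  have hR := (two_pow_r₀_bounds N).1
  have hsz : N < 2 ^ Nat.size N := Nat.lt_size_self N
  -- as naturals: 256 * (N^8 + 1) ≤ 2 ^ (2 ^ r₀)
  have hnat : 256 * (N ^ 8 + 1) ≤ 2 ^ (2 ^ HPolys.r₀ N) := by
    have h1 : 256 * (N ^ 8 + 1) ≤ 2 ^ (8 * (Nat.size N + 1)) := by
      rw [show 8 * (Nat.size N + 1) = 8 * Nat.size N + 8 by ring, pow_add, pow_mul']
      have : N ^ 8 + 1 ≤ (2 ^ Nat.size N) ^ 8 := by
        calc N ^ 8 + 1 ≤ (N + 1) ^ 8 := Nat.pow_lt_pow_left (Nat.lt_succ_self N) (by norm_num)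
          _ ≤ (2 ^ Nat.size N) ^ 8 := Nat.pow_le_pow_left hsz 8
      calc 256 * (N ^ 8 + 1) ≤ 256 * (2 ^ Nat.size N) ^ 8 := Nat.mul_le_mul_left _ this
        _ = (2 ^ Nat.size N) ^ 8 * 2 ^ 8 := by ring
    exact h1.trans (Nat.pow_le_pow_right (by norm_num) hR.le)
  have hreal : (256 : ℝ) * ((N : ℝ) ^ 8 + 1) ≤ exp (sP N).R := by
    have h1 : ((256 * (N ^ 8 + 1) : ℕ) : ℝ) ≤ ((2 ^ (2 ^ HPolys.r₀ N) : ℕ) : ℝ) := by exact_mod_cast hnat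
    push_cast at h1
    have h2 := two_pow_le_exp_nat (2 ^ HPolys.r₀ N)
    push_cast at h2
    exact h1.trans h2
  rw [Real.exp_neg, inv_eq_one_div, div_le_div_iff_of_pos_left one_pos (Real.exp_pos _) (by positivity)]
  exact hreal

/-- `e^{-R} ≤ 1/(256 n)` for `1 ≤ n ≤ N`. [folklore] -/
theorem exp_neg_R_le' (hn : 1 ≤ n) (hnN : n ≤ N) : exp (-(sP N).R) ≤ 1 / (256 * (n : ℝ)) := by
  refine (exp_neg_R_le N).trans ?_
  have hn' : (1 : ℝ) ≤ n := by exact_mod_cast hn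
  have hnN' : (n : ℝ) ≤ N := by exact_mod_cast hnN
  have : (n : ℝ) ≤ (N : ℝ) ^ 8 + 1 := by
    have h8 : (N : ℝ) ≤ (N : ℝ) ^ 8 := by
      rcases Nat.eq_zero_or_pos N with h | h
      · simp [h]
      · exact le_self_pow₀ (by exact_mod_cast h) (by norm_num)
    linarith
  exact div_le_div_of_nonneg_left (by norm_num) (by positivity) (by nlinarith)

/-- **`e^{2R} ≥ 32 N³ + 1`** (the range tail): `e^{2R} ≥ 2^{2R} ≥ 2^{16(size N+1)}`. [folklore] -/
theorem le_exp_two_R (N : ℕ) : 32 * (N : ℝ) ^ 3 + 1 ≤ exp (2 * (sP N).R) := by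
  have hR := (two_pow_r₀_bounds N).1
  have hsz : N < 2 ^ Nat.size N := Nat.lt_size_self N
  have hnat : 32 * N ^ 3 + 1 ≤ 2 ^ (2 * 2 ^ HPolys.r₀ N) := by
    have h1 : 32 * N ^ 3 + 1 ≤ 2 ^ (16 * (Nat.size N + 1)) := by
      rw [show 16 * (Nat.size N + 1) = 16 * Nat.size N + 16 by ring, pow_add, pow_mul']
      have h3 : N ^ 3 ≤ (2 ^ Nat.size N) ^ 16 := by
        calc N ^ 3 ≤ (2 ^ Nat.size N) ^ 3 := Nat.pow_le_pow_left hsz.le 3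
          _ ≤ (2 ^ Nat.size N) ^ 16 := Nat.pow_le_pow_right (by positivity) (by norm_num)
      have h4 : 1 ≤ (2 ^ Nat.size N) ^ 16 := Nat.one_le_pow _ _ (by positivity)
      calc 32 * N ^ 3 + 1 ≤ 32 * (2 ^ Nat.size N) ^ 16 + (2 ^ Nat.size N) ^ 16 := by omega
        _ ≤ (2 ^ Nat.size N) ^ 16 * 2 ^ 16 := by nlinarith
    exact h1.trans (Nat.pow_le_pow_right (by norm_num) (by omega))
  have h1 : ((32 * N ^ 3 + 1 : ℕ) : ℝ) ≤ ((2 ^ (2 * 2 ^ HPolys.r₀ N) : ℕ) : ℝ) := by exact_mod_cast hnat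
  push_cast at h1
  have h2 := two_pow_le_exp_nat (2 * 2 ^ HPolys.r₀ N)
  have h3 : exp ((2 * 2 ^ HPolys.r₀ N : ℕ) : ℝ) = exp (2 * (sP N).R) := by
    congr 1; unfold PGParams.R; push_cast; rfl
  rw [← h3]
  push_cast at h2 ⊢
  exact h1.trans h2

/-! ### The acceptance failure `p₀^J` -/

/-- `e⁴ ≥ 32` and `e^{2N} ≥ N²`. [folklore] -/
theorem thirtytwo_mul_sq_le_exp (N : ℕ) : 32 * (N : ℝ) ^ 2 ≤ exp (2 * N + 4) := by
  have h1 : (32 : ℝ) ≤ exp 4 := by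
    have he : (2.7 : ℝ) ≤ exp 1 := by have := Real.exp_one_gt_d9; linarith
    have h4 : exp (4 : ℝ) = (exp 1) ^ 4 := by rw [Real.exp_one_pow]; norm_num
    rw [h4]
    calc (32 : ℝ) ≤ 2.7 ^ 4 := by norm_num
      _ ≤ (exp 1) ^ 4 := pow_le_pow_left₀ (by norm_num) he 4
  have h2 : (N : ℝ) ^ 2 ≤ exp (2 * N) := by
    have h := Real.add_one_le_exp (N : ℝ)
    have hN : (0 : ℝ) ≤ N := Nat.cast_nonneg N
    calc (N : ℝ) ^ 2 ≤ ((N : ℝ) + 1) ^ 2 := by nlinarith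
      _ ≤ (exp N) ^ 2 := pow_le_pow_left₀ (by positivity) h 2
      _ = exp (2 * N) := by rw [← Real.exp_nat_mul]; ring_nf
  rw [Real.exp_add]
  nlinarith [Real.exp_pos (2 * (N : ℝ)), Real.exp_pos (4 : ℝ)]

/-- **`p₀^J ≤ 1/(32N²)`** (`N ≥ 1`): `p₀^J ≤ e^{-J e^{-2}/R}` with `J e^{-2}/R ≥ 2N + 4`. [folklore] -/
theorem sP_pNone_pow_le (hN : 1 ≤ N) : (sP N).pNone ^ (sP N).J ≤ 1 / (32 * (N : ℝ) ^ 2) := by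
  have hN' : (1 : ℝ) ≤ N := by exact_mod_cast hN
  have h := (sP N).pNone_pow_le (sP_one_le_k hN) (sP_one_le_r N)
  refine h.trans ?_
  have hR := sP_R_le N
  have hRpos : 0 < (sP N).R := by unfold PGParams.R; positivity
  have hJ : ((sP N).J : ℝ) = 128 * ((N : ℝ) + 1) * (2 * N + 4) := by
    show ((hidH.J N : ℕ) : ℝ) = _
    rw [hidH_J]; push_cast; ring
  -- `J e^{-2} / R ≥ 2N + 4`
  have he2 : 1 / 8 ≤ exp (-2 : ℝ) := by
    rw [Real.exp_neg, le_inv_comm₀ (by norm_num) (Real.exp_pos _)]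
    have he : exp 1 ≤ (2.72 : ℝ) := by have := Real.exp_one_lt_d9; linarith
    have h2 : exp (2 : ℝ) = (exp 1) ^ 2 := by rw [Real.exp_one_pow]; norm_num
    rw [h2]
    calc (exp 1) ^ 2 ≤ 2.72 ^ 2 := pow_le_pow_left₀ (Real.exp_pos 1).le he 2
      _ ≤ (1 / 8)⁻¹ := by norm_num
  have hexp : ((sP N).J : ℝ) * exp (-2) / (sP N).R ≥ 2 * N + 4 := by
    rw [ge_iff_le, le_div_iff₀ hRpos, hJ]
    calc (2 * (N : ℝ) + 4) * (sP N).R ≤ (2 * N + 4) * (16 * (N + 1)) := by gcongr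
      _ = 128 * ((N : ℝ) + 1) * (2 * N + 4) * (1 / 8) := by ring
      _ ≤ 128 * ((N : ℝ) + 1) * (2 * N + 4) * exp (-2) := by gcongr
  have hmono : exp (-(((sP N).J : ℝ) * exp (-2) / (sP N).R)) ≤ exp (-(2 * (N : ℝ) + 4)) :=
    Real.exp_le_exp.2 (by linarith)
  refine hmono.trans ?_
  rw [Real.exp_neg, inv_eq_one_div, div_le_div_iff_of_pos_left one_pos (Real.exp_pos _) (by positivity)]
  exact thirtytwo_mul_sq_le_exp N

/-- `p₀^J ≤ 1/2` and `< 1` (`N ≥ 1`). [folklore] -/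
theorem sP_pNone_pow_le_half (hN : 1 ≤ N) : (sP N).pNone ^ (sP N).J ≤ 1 / 2 ∧ (sP N).pNone ^ (sP N).J < 1 := by
  have h := sP_pNone_pow_le hN
  have hN' : (1 : ℝ) ≤ N := by exact_mod_cast hN
  have h2 : 1 / (32 * (N : ℝ) ^ 2) ≤ 1 / 32 := div_le_div_of_nonneg_left (by norm_num) (by norm_num) (by nlinarith)
  constructor <;> linarith

/-! ### The second moment -/

/-- **`1/400 ≤ v`.** [folklore] -/
theorem sP_le_v (hN : 1 ≤ N) : 1 / 400 ≤ (sP N).v :=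
  (sP N).le_v (sP_one_le_b N) (sP_one_le_k hN) (sP_pNone_pow_le_half hN).1

/-- **`2v ≤ 1 + 1/n`** for `1 ≤ n ≤ N`: the numerator `e^q √(1+2q)(1+h) ≤ 1 + 1/(4n)` and the
denominator `≥ 1 - 1/(8n)` of `v_le'`. [folklore] -/
theorem sP_two_v_le (hn : 1 ≤ n) (hnN : n ≤ N) : 2 * (sP N).v ≤ 1 + 1 / (n : ℝ) := by
  have hN : 1 ≤ N := hn.trans hnN
  have hn' : (1 : ℝ) ≤ n := by exact_mod_cast hn
  have hnN' : (n : ℝ) ≤ N := by exact_mod_cast hnN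
  have hq := sP_q_le hN
  have hq1 := sP_q_le_one N
  have hq0 : 0 < (sP N).q := (sP N).q_pos
  have hh := sP_h_le hN
  have hh0 : 0 < (sP N).h := (sP N).h_pos
  have heR := exp_neg_R_le' hn hnN
  -- the small parameter `x = 1/(32 n)` dominates `q` and `h`
  have hx : (sP N).q ≤ 1 / (32 * (n : ℝ)) ∧ (sP N).h ≤ 1 / (32 * (n : ℝ)) := by
    have : 1 / (64 * (N : ℝ) ^ 2) ≤ 1 / (32 * (n : ℝ)) := by
      rw [div_le_div_iff_of_pos_left one_pos (by positivity) (by positivity)]; nlinarith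
    have h' : 1 / (32 * (N : ℝ) ^ 2) ≤ 1 / (32 * (n : ℝ)) := by
      rw [div_le_div_iff_of_pos_left one_pos (by positivity) (by positivity)]; nlinarith
    exact ⟨hq.trans this, hh.trans h'⟩
  -- numerator bounds
  have hexpq : exp (sP N).q ≤ 1 + 2 * (sP N).q := by
    have := Real.abs_exp_sub_one_le (x := (sP N).q) (by rw [abs_of_pos hq0]; exact hq1)
    rw [abs_of_pos hq0] at this
    have := (abs_le.1 this).2
    linarith
  have hsqrt : √(1 + 2 * (sP N).q) ≤ 1 + (sP N).q := by
    rw [Real.sqrt_le_left (by positivity)]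
    nlinarith
  have hsqrt1 : 1 ≤ √(1 + 2 * (sP N).q) := by
    rw [Real.le_sqrt (by norm_num) (by positivity)]; nlinarith
  have hπ : 1 ≤ √π := by
    rw [Real.le_sqrt (by norm_num) Real.pi_pos.le]; linarith [Real.pi_gt_three]
  -- denominator
  set D : ℝ := 1 - (2 * exp (-(sP N).R) + (sP N).h * √(1 + 2 * (sP N).q)) / √π with hD
  have hsmall : (2 * exp (-(sP N).R) + (sP N).h * √(1 + 2 * (sP N).q)) / √π ≤ 1 / (8 * (n : ℝ)) := by
    have hnum : 2 * exp (-(sP N).R) + (sP N).h * √(1 + 2 * (sP N).q) ≤ 1 / (8 * (n : ℝ)) := by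
      set w : ℝ := 1 / (n : ℝ) with hw
      have hw0 : 0 < w := by positivity
      have hw1 : w ≤ 1 := by rw [hw, div_le_one (by positivity)]; exact hn'
      have e1 : 1 / (256 * (n : ℝ)) = w / 256 := by rw [hw]; ring
      have e2 : 1 / (32 * (n : ℝ)) = w / 32 := by rw [hw]; ring
      have e3 : 1 / (8 * (n : ℝ)) = w / 8 := by rw [hw]; ring
      rw [e1] at heR
      rw [e2] at hx
      rw [e3]
      have h1 : (sP N).h * √(1 + 2 * (sP N).q) ≤ (w / 32) * (1 + w / 32) := by
        calc (sP N).h * √(1 + 2 * (sP N).q) ≤ (sP N).h * (1 + (sP N).q) := mul_le_mul_of_nonneg_left hsqrt hh0.le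
          _ ≤ (w / 32) * (1 + w / 32) := by gcongr <;> linarith [hx.1, hx.2]
      nlinarith
    calc (2 * exp (-(sP N).R) + (sP N).h * √(1 + 2 * (sP N).q)) / √π
        ≤ (2 * exp (-(sP N).R) + (sP N).h * √(1 + 2 * (sP N).q)) / 1 :=
          div_le_div_of_nonneg_left (by positivity) one_pos hπ
      _ ≤ 1 / (8 * (n : ℝ)) := by rw [div_one]; exact hnum
  have hDpos : 0 < D := by
    have : 1 / (8 * (n : ℝ)) ≤ 1 / 8 := div_le_div_of_nonneg_left (by norm_num) (by norm_num) (by linarith)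
    rw [hD]; linarith
  have hv := (sP N).v_le' (sP_one_le_k hN) (sP_one_le_R N) hDpos
  -- combine: `2v ≤ A/D` with `A ≤ 1 + 1/(4n)`, `D ≥ 1 - 1/(8n)`
  have hA : exp (sP N).q * √(1 + 2 * (sP N).q) * (1 + (sP N).h) ≤ 1 + 1 / (4 * (n : ℝ)) := by
    set x : ℝ := 1 / (32 * (n : ℝ)) with hxdef
    have hx0 : 0 ≤ x := by positivity
    have hx32 : x ≤ 1 / 32 := div_le_div_of_nonneg_left (by norm_num) (by norm_num) (by linarith)
    calc exp (sP N).q * √(1 + 2 * (sP N).q) * (1 + (sP N).h)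
        ≤ (1 + 2 * x) * (1 + x) * (1 + x) := by
          have h1 : exp (sP N).q ≤ 1 + 2 * x := by linarith [hx.1]
          have h2 : √(1 + 2 * (sP N).q) ≤ 1 + x := by linarith [hx.1]
          have h3 : 1 + (sP N).h ≤ 1 + x := by linarith [hx.2]
          have := mul_le_mul h1 h2 (by positivity) (by positivity)
          exact mul_le_mul this h3 (by positivity) (by positivity)
      _ ≤ 1 + 1 / (4 * (n : ℝ)) := by
          have : 1 / (4 * (n : ℝ)) = 8 * x := by rw [hxdef]; field_simp; ring
          rw [this]
          have hx2 : x ^ 2 ≤ x / 32 := by nlinarith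
          have hx3 : x ^ 3 ≤ x / 1024 := by nlinarith
          nlinarith
  have h2v : 2 * (sP N).v ≤ (1 + 1 / (4 * (n : ℝ))) / (1 - 1 / (8 * (n : ℝ))) := by
    have hD' : 1 - 1 / (8 * (n : ℝ)) ≤ D := by rw [hD]; linarith
    have hD'pos : 0 < 1 - 1 / (8 * (n : ℝ)) := by
      have : 1 / (8 * (n : ℝ)) ≤ 1 / 8 := div_le_div_of_nonneg_left (by norm_num) (by norm_num) (by linarith)
      linarith
    calc 2 * (sP N).v ≤ 2 * (1 / 2 * (exp (sP N).q * √(1 + 2 * (sP N).q) * (1 + (sP N).h)) / D) := by linarith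
      _ = (exp (sP N).q * √(1 + 2 * (sP N).q) * (1 + (sP N).h)) / D := by ring
      _ ≤ (1 + 1 / (4 * (n : ℝ))) / D := div_le_div_of_nonneg_right hA hDpos.le
      _ ≤ (1 + 1 / (4 * (n : ℝ))) / (1 - 1 / (8 * (n : ℝ))) := div_le_div_of_nonneg_left (by positivity) hD'pos hD'
  refine h2v.trans ?_
  set w : ℝ := 1 / (n : ℝ) with hw
  have hw0 : 0 < w := by positivity
  have hw1 : w ≤ 1 := by rw [hw, div_le_one (by positivity)]; exact hn'
  have e4 : 1 / (4 * (n : ℝ)) = w / 4 := by rw [hw]; ring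
  have e8 : 1 / (8 * (n : ℝ)) = w / 8 := by rw [hw]; ring
  rw [e4, e8, div_le_iff₀ (by linarith)]
  nlinarith

/-- **`(2v)ⁿ ≤ 3`** (from `2v ≤ 1 + 1/n` and `(1 + 1/n)ⁿ ≤ e < 3`). [folklore] -/
theorem pow_two_v_le_three (hn : 1 ≤ n) (hnN : n ≤ N) : (2 * (sP N).v) ^ n ≤ 3 := by
  have h := sP_two_v_le hn hnN
  have hv0 : 0 ≤ 2 * (sP N).v := by have := sP_le_v (hn.trans hnN); linarith
  have hn' : (0 : ℝ) < n := by exact_mod_cast hn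
  calc (2 * (sP N).v) ^ n ≤ (1 + 1 / (n : ℝ)) ^ n := pow_le_pow_left₀ hv0 h n
    _ ≤ (exp (1 / (n : ℝ))) ^ n := pow_le_pow_left₀ (by positivity) (by have := Real.add_one_le_exp (1 / (n : ℝ)); linarith) n
    _ = exp 1 := by rw [← Real.exp_nat_mul]; congr 1; field_simp
    _ ≤ 3 := by have := Real.exp_one_lt_d9; linarith

/-- **The second moment `s = 2·4ᵇ·v` is positive and `≥ 4ᵇ/200`.** [folklore] -/
theorem sP_s_bounds (hN : 1 ≤ N) : 0 < 2 * (4 : ℝ) ^ (sP N).b * (sP N).v ∧ (4 : ℝ) ^ (sP N).b / 200 ≤ 2 * 4 ^ (sP N).b * (sP N).v := by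
  have hv := sP_le_v hN
  have h4 : (0 : ℝ) < 4 ^ (sP N).b := by positivity
  constructor
  · positivity
  · rw [div_le_iff₀ (by norm_num)]; nlinarith

/-! ### The domination factor -/

/-- The domination factor `F = e^{hR + 2qR² + q}(1+h)/(1 − p₀^J)` of `gaussBox_le_mul_law`. [folklore] -/
def domF (N : ℕ) : ℝ :=
  exp ((sP N).h * (sP N).R + 2 * (sP N).q * (sP N).R ^ 2 + (sP N).q) * (1 + (sP N).h) / (1 - (sP N).pNone ^ (sP N).J)

/-- **The rounded Gaussian box is dominated by the sampler's law**: `ℓ_b(j) ≤ F · ℓ'(j)` on `|j| < T`.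
[folklore] -/
theorem gaussBox_le_domF_mul_law (hN : 1 ≤ N) {j : ℤ} (hj : j.natAbs < (sP N).T) :
    gaussBox (sP N).b j ≤ domF N * (sP N).law j :=
  (sP N).gaussBox_le_mul_law (sP_one_le_k hN) (sP_pNone_pow_le_half hN).2 hj

/-- `0 ≤ F`. [folklore] -/
theorem domF_nonneg (hN : 1 ≤ N) : 0 ≤ domF N := by
  unfold domF
  have := (sP_pNone_pow_le_half hN).2
  have := (sP N).h_pos
  exact div_nonneg (by positivity) (by linarith)

/-- **`F ≤ e^{6/(32N²)}`**: each of `hR`, `2qR²`, `q`, `h` is `≤ 1/(32N²)`, `1 + h ≤ e^h`,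
`1/(1 − p) ≤ e^{2p}` for `p = p₀^J ≤ 1/(32N²)`. [folklore] -/
theorem domF_le_exp (hN : 1 ≤ N) : domF N ≤ exp (6 / (32 * (N : ℝ) ^ 2)) := by
  have hN' : (1 : ℝ) ≤ N := by exact_mod_cast hN
  have h1 := sP_hR_le hN
  have h2 := sP_qR_sq_le hN
  have h3 := sP_q_le hN
  have h4 := sP_h_le hN
  have h5 := sP_pNone_pow_le hN
  have hp0 : 0 ≤ (sP N).pNone ^ (sP N).J := pow_nonneg (sP N).pNone_nonneg _
  set y : ℝ := 1 / (32 * (N : ℝ) ^ 2) with hy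
  have hy0 : 0 < y := by positivity
  have hy32 : y ≤ 1 / 32 := div_le_div_of_nonneg_left (by norm_num) (by norm_num) (by nlinarith)
  have hyy : y = 2 * (1 / (64 * (N : ℝ) ^ 2)) := by rw [hy]; field_simp; ring
  -- exponent ≤ 3y
  have hexp : (sP N).h * (sP N).R + 2 * (sP N).q * (sP N).R ^ 2 + (sP N).q ≤ 3 * y := by
    have hq0 : 0 ≤ (sP N).q := (sP N).q_pos.le
    linarith
  -- `1 + h ≤ e^y`
  have hh : 1 + (sP N).h ≤ exp y := by
    have := Real.add_one_le_exp y; linarith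
  -- `1/(1-p) ≤ e^{2y}`
  have hp : 1 / (1 - (sP N).pNone ^ (sP N).J) ≤ exp (2 * y) := by
    have hp1 : (sP N).pNone ^ (sP N).J ≤ y := h5
    have hlt : (sP N).pNone ^ (sP N).J < 1 := by linarith
    rw [div_le_iff₀ (by linarith)]
    -- `1 ≤ e^{2y}(1 - p)` from `e^{2y} ≥ 1 + 2y` and `(1+2y)(1-y) ≥ 1`
    have he : 1 + 2 * y ≤ exp (2 * y) := by have := Real.add_one_le_exp (2 * y); linarith
    calc (1 : ℝ) ≤ (1 + 2 * y) * (1 - y) := by nlinarith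
      _ ≤ exp (2 * y) * (1 - (sP N).pNone ^ (sP N).J) := by
          apply mul_le_mul he (by linarith) (by linarith) (Real.exp_pos _).le
  unfold domF
  calc exp ((sP N).h * (sP N).R + 2 * (sP N).q * (sP N).R ^ 2 + (sP N).q) * (1 + (sP N).h) / (1 - (sP N).pNone ^ (sP N).J)
      = exp ((sP N).h * (sP N).R + 2 * (sP N).q * (sP N).R ^ 2 + (sP N).q) * (1 + (sP N).h) *
          (1 / (1 - (sP N).pNone ^ (sP N).J)) := by ring
    _ ≤ exp (3 * y) * exp y * exp (2 * y) := by
        apply mul_le_mul (mul_le_mul (Real.exp_le_exp.2 hexp) hh (by have := (sP N).h_pos; positivity) (Real.exp_pos _).le)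
          hp (by have := (sP_pNone_pow_le_half hN).2; positivity) (by positivity)
    _ = exp (6 / (32 * (N : ℝ) ^ 2)) := by rw [← Real.exp_add, ← Real.exp_add, hy]; congr 1; ring

/-- **`F^{2n²} ≤ 2`** for `1 ≤ n ≤ N` (`e^{12/32} < 2`). [folklore] -/
theorem domF_pow_le_two (hn : 1 ≤ n) (hnN : n ≤ N) : domF N ^ (2 * (n * n)) ≤ 2 := by
  have hN : 1 ≤ N := hn.trans hnN
  have hN' : (1 : ℝ) ≤ N := by exact_mod_cast hN
  have hnN' : (n : ℝ) ≤ N := by exact_mod_cast hnN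
  have hF := domF_le_exp hN
  have hF0 := domF_nonneg hN
  calc domF N ^ (2 * (n * n)) ≤ (exp (6 / (32 * (N : ℝ) ^ 2))) ^ (2 * (n * n)) := pow_le_pow_left₀ hF0 hF _
    _ = exp ((2 * (n * n) : ℕ) * (6 / (32 * (N : ℝ) ^ 2))) := by rw [← Real.exp_nat_mul]
    _ ≤ exp (3 / 8) := by
        refine Real.exp_le_exp.2 ?_
        push_cast
        rw [show (2 : ℝ) * (n * n) * (6 / (32 * (N : ℝ) ^ 2)) = 3 / 8 * ((n : ℝ) ^ 2 / (N : ℝ) ^ 2) by field_simp; ring]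
        have : (n : ℝ) ^ 2 / (N : ℝ) ^ 2 ≤ 1 := by
          rw [div_le_one (by positivity)]; nlinarith
        nlinarith
    _ ≤ 2 := by
        have h := Real.abs_exp_sub_one_sub_id_le (x := 3 / 8) (by rw [abs_of_pos (by norm_num)]; norm_num)
        have := (abs_le.1 h).2
        nlinarith

end Literature.Computability.QuantumComplexity
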